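import Summits.HodgeConjecture.HodgeConjecture.Theorems.Ring2AbelianAllAndreFibreClassDivisionNodes
import Summits.HodgeConjecture.HodgeConjecture.Theorems.Ring2AbelianAllAndreInvariantHodgeTypesDegree
import HarnessLib

/-!
# Ring 2 · sub-cell AbelianAll (ALL ABELIAN VARIETIES), André axis, part XXIX-g — `j_{t*}` DETECTS THE HODGE TYPE OF INVARIANT
# CLASSES: `x ∪ [𝒳_t]` is of type `(p'+1, q'+1)` on the total space iff `j_t^* x` is of type `(p', q')` on the fibre; so the
# habitat clause and the Hodge side of (Div) can be read on the total space

HONEST FRAMING (page 1, verbatim): **research route, not a corollary; conditional on HC_CM plus one named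
minimal statement.** Cell line: research route conditional on HC_CM; not a corollary; Q11.4-sentence-2
already refuted in dim ≥ 3. Nothing in this file proves a case of the Hodge conjecture for an abelian variety. `HC_CM` does NOT
occur in this file; item `Theses.RankFourFaces.CMToAbelian` (stmt-HodgeConjecture-16267) OPEN and not closed here. Seat
`pub-hodge-ring2-ab-andre-2`, gen 21; addendum to part XXIX (owed item (o71) of RING2-MAP AA2.171).

## The point

Part XXIX replaced "algebraic on the fibre" (pulled back along `j_t^*`) by "algebraic on the total space" (pulled back along
`L_t = j_{t*} j_t^* = (· ∪ [𝒳_t])`). This part does the same for HODGE TYPES: for a compact pencil of abelian `d`-folds, a global class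
`x ∈ H^{2p}(𝒳(ℂ); ℂ)` and `p' + q' = 2p`,
  **`L_t x` is of type `(p'+1, q'+1)` on `𝒳`  ⟺  `j_t^* x` is of type `(p', q')` on `𝒳_t`**
(`isOfHodgeType_fiberGysin_map_fiberι_iff`). ⟸ is the bidegree `(1,1)` of the Gysin map (part X-b, Voisin I §7.3.2); ⟹ is new on
the carriers: the type projectors of ONE Hodge model of `𝒳` commute with `L_t` up to the shift `(a,b) ↦ (a+1,b+1)` (§1, the tree's
`HodgeModel.lefschetzOperator_typeProj` argument run for an arbitrary type-shifting linear map), so "`L_t x` of type `(p'+1,q'+1)`"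
says that `L_t` kills every other type component of `x`, i.e. (Deligne's kernel identity κ_f, a tree theorem) that `j_t^*` kills
them — which is "`j_t^* x` of type `(p',q')`" (part XVI-a). Consequences: the habitat clause "every invariant class of degree `2p` is
of type `(p,p)` on the fibre" reads "`[𝒳_t] ∪ H^{2p}(𝒳(ℂ); ℂ) ⊆ H^{p+1,p+1}(𝒳)`"; an invariant class whose fibre-class multiple is
ALGEBRAIC is of type `(p,p)` on the fibre (so in (Div)'s hypothesis the class `j_t^* x` is automatically Hodge-theoretically a
`(p,p)`-class: (Div) and (L) differ exactly by "such classes are algebraic on the fibre").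

## What is proved (theorems only; no definition, no named fact, no sorry)

§1 (any smooth projective `X`, `Y`, Hodge models `A`, `B`, a linear `T : Hᵏ(X) → Hˡ(Y)`, `l = k + 2`, mapping `A`-type `(a,b)` into
`B`-type `(a+1,b+1)`): `typeProj_comm_of_typeShift` (`T ∘ π^A_{(a,b)} = π^B_{(a+1,b+1)} ∘ T`), `typeProj_eq_zero_of_forall_ne_typeShift`
(the components of `T c` off the shifted types vanish), **`isOfHodgeType_iff_forall_typeProj_of_typeShift`** (`T c` of type `(p+1,q+1)`
iff `T` kills the other type components of `c`).
§2 (compact abelian pencils, `L_t = j_{t*} j_t^*`): `typeProj_fiberGysin_map_fiberι`, **`isOfHodgeType_fiberGysin_map_fiberι_iff`**,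
`forall_hodgeType_map_fiberι_iff_forall_fiberGysin` (the habitat clause on the total space),
`isOfHodgeType_map_fiberι_of_fiberGysin_mem_algebraicClasses` (fibre-class multiple algebraic ⟹ restriction of type `(p,p)`),
`algebraicInvariantClassesAt_iff_forall_isOfHodgeType_fiberGysin_of_hodgeClassesAlgebraic` ((N_p f)(t) ⟺ "every
`x ∪ [𝒳_t]` is of type `(p+1,p+1)`", modulo `HC^p(𝒳)`, via part XVI-b).

## Honest status

Nothing here is progress on `HC_AV`; no node is born; nothing is minimal; the rationality companion ("`L_t x` rational ⟹ `j_t^* x`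
rational up to `ker j_t^*`") is not addressed (it needs rational descent through `j_{t*}|Im j_t^*`, owed (o71) second half).

References: VoisinHodgeI2002 (Thm. 6.18, Rem. 6.27, §7.1.1, §7.3.2 with Lemma 7.30); DeligneHodgeII1971 (Thm. 4.1.1, Cor. 4.1.2);
Abdulali1994FamiliesAV (Thm. 5.5); FultonYoungTableaux1997 (App. B (5)–(6)); Andre1996Motifs (§5.1).
-/

noncomputable section

set_option linter.dupNamespace false

namespace Summit.HodgeConjecture.HodgeConjecture.Ring2.AbelianAll

open CategoryTheory AlgebraicGeometry
open Literature.AlgebraicGeometry Literature.AlgebraicGeometry.Motives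
open Literature.AlgebraicGeometry.HodgeTheory
open Literature.AlgebraicGeometry.HodgeTheory.HodgeModel (typeShift typeShift_injective)
open Literature.AlgebraicTopology.SingularHomology (singularCohomology)
open Summit.HodgeConjecture.HodgeConjecture

/-! ## §1 Type projectors commute with a type-shifting linear map -/

section Shift

variable {n m : ℕ} {X Y : SchemeOver ℂ}

/-- **A linear map of bidegree `(1,1)` commutes with the type projectors up to the shift of types**: for Hodge models `A` of `X`,
`B` of `Y`, `l = 2 + k`, and `T : Hᵏ(X(ℂ); ℂ) → Hˡ(Y(ℂ); ℂ)` mapping the `A`-type piece `(a,b)` into the `B`-type piece `(a+1,b+1)`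
for every `(a,b)`: `T(π^A_{(a,b)} c) = π^B_{(a+1,b+1)}(T c)` (uniqueness of the type decomposition of `T c`; the tree's
`HodgeModel.lefschetzOperator_typeProj` is the case `T = η ∪ ·`, `X = Y`). [cite: VoisinHodgeI2002, Thm. 6.18 and §6.2.3 Rem. 6.27] -/
theorem typeProj_comm_of_typeShift (A : HodgeModel n X) (B : HodgeModel m Y) {k l : ℕ} (hkl : 2 + k = l)
    (T : complexBetti X k →ₗ[ℂ] complexBetti Y l)
    (hT : ∀ (pq : ↥(Finset.HasAntidiagonal.antidiagonal k)) (c : complexBetti X k),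
      c ∈ A.typePiece k pq → T c ∈ B.typePiece l (typeShift hkl pq))
    (pq : ↥(Finset.HasAntidiagonal.antidiagonal k)) (c : complexBetti X k) :
    T (A.typeProj k pq c) = B.typeProj l (typeShift hkl pq) (T c) := by
  classical
  let y : ↥(Finset.HasAntidiagonal.antidiagonal l) → complexBetti Y l := fun i' ↦
    ∑ i ∈ Finset.univ.filter (fun i ↦ typeShift hkl i = i'), T (A.typeProj k i c)
  have hy : ∀ i', y i' ∈ B.typePiece l i' := by
    intro i'
    refine Submodule.sum_mem _ fun i hi ↦ ?_
    rw [Finset.mem_filter] at hi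
    rw [← hi.2]
    exact hT i _ (A.typeProj_mem k i c)
  have hsum : ∑ i', y i' = T c := by
    rw [Finset.sum_fiberwise Finset.univ (typeShift hkl) (fun i ↦ T (A.typeProj k i c)), ← map_sum, A.sum_typeProj]
  rw [B.typeProj_eq_of_sum_eq hy hsum (typeShift hkl pq)]
  change _ = ∑ i ∈ Finset.univ.filter (fun i ↦ typeShift hkl i = typeShift hkl pq), T (A.typeProj k i c)
  rw [Finset.sum_eq_single pq]
  · intro i hi hipq
    rw [Finset.mem_filter] at hi
    exact absurd (typeShift_injective hkl hi.2) hipq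
  · intro h
    exact absurd (Finset.mem_filter.2 ⟨Finset.mem_univ pq, rfl⟩ :
      pq ∈ Finset.univ.filter (fun i ↦ typeShift hkl i = typeShift hkl pq)) h

/-- **Off the shifted types the components of `T c` vanish**: if `i'` is not of the form `(a+1,b+1)` (i.e. `i' = (0,l)` or
`(l,0)`), then `π^B_{i'}(T c) = 0`. [cite: VoisinHodgeI2002, Thm. 6.18] -/
theorem typeProj_eq_zero_of_forall_ne_typeShift (A : HodgeModel n X) (B : HodgeModel m Y) {k l : ℕ} (hkl : 2 + k = l)
    (T : complexBetti X k →ₗ[ℂ] complexBetti Y l)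
    (hT : ∀ (pq : ↥(Finset.HasAntidiagonal.antidiagonal k)) (c : complexBetti X k),
      c ∈ A.typePiece k pq → T c ∈ B.typePiece l (typeShift hkl pq))
    (i' : ↥(Finset.HasAntidiagonal.antidiagonal l)) (hi' : ∀ i, typeShift hkl i ≠ i') (c : complexBetti X k) :
    B.typeProj l i' (T c) = 0 := by
  classical
  let y : ↥(Finset.HasAntidiagonal.antidiagonal l) → complexBetti Y l := fun i'' ↦
    ∑ i ∈ Finset.univ.filter (fun i ↦ typeShift hkl i = i''), T (A.typeProj k i c)
  have hy : ∀ i'', y i'' ∈ B.typePiece l i'' := by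
    intro i''
    refine Submodule.sum_mem _ fun i hi ↦ ?_
    rw [Finset.mem_filter] at hi
    rw [← hi.2]
    exact hT i _ (A.typeProj_mem k i c)
  have hsum : ∑ i'', y i'' = T c := by
    rw [Finset.sum_fiberwise Finset.univ (typeShift hkl) (fun i ↦ T (A.typeProj k i c)), ← map_sum, A.sum_typeProj]
  rw [B.typeProj_eq_of_sum_eq hy hsum i']
  change ∑ i ∈ Finset.univ.filter (fun i ↦ typeShift hkl i = i'), T (A.typeProj k i c) = 0
  refine Finset.sum_eq_zero fun i hi ↦ ?_
  rw [Finset.mem_filter] at hi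
  exact absurd hi.2 (hi' i)

/-- **`T c` is of type `(p+1, q+1)` iff `T` kills every OTHER type component of `c`** (`p + q = k`; `T` as above, `Y` smooth
projective of dimension `m`). [cite: VoisinHodgeI2002, Thm. 6.18 and §7.1.1] -/
theorem isOfHodgeType_iff_forall_typeProj_of_typeShift (hY : IsSmoothProjective m Y) (A : HodgeModel n X) (B : HodgeModel m Y)
    {k l : ℕ} (hkl : 2 + k = l) (T : complexBetti X k →ₗ[ℂ] complexBetti Y l)
    (hT : ∀ (pq : ↥(Finset.HasAntidiagonal.antidiagonal k)) (c : complexBetti X k),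
      c ∈ A.typePiece k pq → T c ∈ B.typePiece l (typeShift hkl pq))
    {p q : ℕ} (hpq : p + q = k) (c : complexBetti X k) :
    IsOfHodgeType m Y l (p + 1) (q + 1) (T c) ↔
      ∀ pq' : ↥(Finset.HasAntidiagonal.antidiagonal k), pq'.1 ≠ (p, q) → T (A.typeProj k pq' c) = 0 := by
  have hmem : (p, q) ∈ Finset.HasAntidiagonal.antidiagonal k := Finset.HasAntidiagonal.mem_antidiagonal.2 hpq
  have hmem' : (p + 1, q + 1) ∈ Finset.HasAntidiagonal.antidiagonal l :=
    Finset.HasAntidiagonal.mem_antidiagonal.2 (by omega)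
  have hshift : typeShift hkl ⟨(p, q), hmem⟩ = ⟨(p + 1, q + 1), hmem'⟩ := rfl
  refine ⟨fun h pq' hne ↦ ?_, fun h ↦ ?_⟩
  · rw [typeProj_comm_of_typeShift A B hkl T hT pq' c]
    refine B.typeProj_apply_of_mem_ne (pq := ⟨(p + 1, q + 1), hmem'⟩) ?_
      (B.mem_typePiece_of_isOfHodgeType hodgePQ_independent_of_hodgeModel_holds hY hmem' h)
    intro heq
    rw [← hshift] at heq
    exact hne (congrArg Subtype.val (typeShift_injective hkl heq)).symm
  · have key : T c = B.typeProj l ⟨(p + 1, q + 1), hmem'⟩ (T c) := by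
      conv_lhs => rw [← B.sum_typeProj l (T c)]
      rw [Finset.sum_eq_single ⟨(p + 1, q + 1), hmem'⟩]
      · intro i' _ hne
        by_cases hi' : ∃ i, typeShift hkl i = i'
        · obtain ⟨i, rfl⟩ := hi'
          rw [← typeProj_comm_of_typeShift A B hkl T hT i c]
          refine h i fun heq ↦ hne ?_
          rw [← hshift]
          exact congrArg (typeShift hkl) (Subtype.ext heq)
        · push Not at hi'
          exact typeProj_eq_zero_of_forall_ne_typeShift A B hkl T hT i' hi' c
      · intro habs
        exact absurd (Finset.mem_univ _) habs
    have hm : T c ∈ B.typePiece l ⟨(p + 1, q + 1), hmem'⟩ := by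
      rw [key]
      exact B.typeProj_mem l ⟨(p + 1, q + 1), hmem'⟩ (T c)
    exact ⟨B, hm⟩

end Shift

/-! ## §2 Compact abelian pencils: the Hodge type of `x ∪ [𝒳_t]` is that of `j_t^* x`, shifted -/

section Pencil

variable {𝒳 S : SchemeOver ℂ} {d : ℕ} {f : 𝒳 ⟶ S}

/-- `L_t = j_{t*} j_t^*` maps the `A`-type piece `(a,b)` of `H^{2p}(𝒳)` into the `A`-type piece `(a+1,b+1)` of `H^{2p+2}(𝒳)`
(part X-b's `isOfHodgeType_fiberGysin_map_fiberι`, read in a model). [cite: VoisinHodgeI2002, §7.3.2 (with Lemma 7.30)] -/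
theorem fiberGysin_map_fiberι_mem_typePiece (hf : IsCompactAbelianPencil f d) (t : ComplexPoints S)
    (A : HodgeModel (d + 1) 𝒳) {p : ℕ} (pq : ↥(Finset.HasAntidiagonal.antidiagonal (2 * p))) (c : complexBetti 𝒳 (2 * p))
    (hc : c ∈ A.typePiece (2 * p) pq) :
    fiberGysin hf t p (complexBetti.map (fiberι f t) (2 * p) c) ∈
      A.typePiece (2 * (p + 1)) (typeShift (show 2 + 2 * p = 2 * (p + 1) by ring) pq) :=
  A.mem_typePiece_of_isOfHodgeType hodgePQ_independent_of_hodgeModel_holds hf.isSmoothProjective_total _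
    (isOfHodgeType_fiberGysin_map_fiberι hf t (A.isOfHodgeType_of_mem_typePiece hc))

/-- **`L_t(π_{(a,b)} x) = π_{(a+1,b+1)}(L_t x)`**: cup product with the fibre class commutes with the type projectors of a
Hodge model of `𝒳` up to the shift. [cite: VoisinHodgeI2002, Thm. 6.18 and §6.2.3 Rem. 6.27] -/
theorem typeProj_fiberGysin_map_fiberι (hf : IsCompactAbelianPencil f d) (t : ComplexPoints S) (A : HodgeModel (d + 1) 𝒳)
    {p : ℕ} (pq : ↥(Finset.HasAntidiagonal.antidiagonal (2 * p))) (x : complexBetti 𝒳 (2 * p)) :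
    fiberGysin hf t p (complexBetti.map (fiberι f t) (2 * p) (A.typeProj (2 * p) pq x)) =
      A.typeProj (2 * (p + 1)) (typeShift (show 2 + 2 * p = 2 * (p + 1) by ring) pq)
        (fiberGysin hf t p (complexBetti.map (fiberι f t) (2 * p) x)) :=
  typeProj_comm_of_typeShift A A (show 2 + 2 * p = 2 * (p + 1) by ring)
    ((fiberGysin hf t p) ∘ₗ (complexBetti.map (fiberι f t) (2 * p)).hom)
    (fun pq' c hc ↦ fiberGysin_map_fiberι_mem_typePiece hf t A pq' c hc) pq x

/-- **`j_{t*}` DETECTS THE HODGE TYPE OF INVARIANT CLASSES**: for `x ∈ H^{2p}(𝒳(ℂ); ℂ)` and `p' + q' = 2p`,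
`L_t x = x ∪ [𝒳_t]` is of type `(p'+1, q'+1)` on `𝒳` iff `j_t^* x` is of type `(p', q')` on the fibre `𝒳_t`. Both say that the
other type components of `x` (in one Hodge model of `𝒳`) die under `L_t`, resp. `j_t^*` — and `L_t y = 0 ⟺ j_t^* y = 0` by
Deligne's kernel identity (a tree theorem). [cite: VoisinHodgeI2002, §7.3.2 (with Lemma 7.30) and Thm. 6.18]
[cite: DeligneHodgeII1971, Thm. 4.1.1] -/
theorem isOfHodgeType_fiberGysin_map_fiberι_iff (hf : IsCompactAbelianPencil f d) (t : ComplexPoints S) {p p' q' : ℕ}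
    (hpq : p' + q' = 2 * p) (x : complexBetti 𝒳 (2 * p)) :
    IsOfHodgeType (d + 1) 𝒳 (2 * (p + 1)) (p' + 1) (q' + 1) (fiberGysin hf t p (complexBetti.map (fiberι f t) (2 * p) x)) ↔
      IsOfHodgeType d (fiberOver f t) (2 * p) p' q' (complexBetti.map (fiberι f t) (2 * p) x) := by
  have h𝒳 := hf.isSmoothProjective_total
  have hXt := hf.isSmoothProjective_fiberOver t
  obtain ⟨A⟩ := nonempty_hodgeModel_holds h𝒳
  have h1 := isOfHodgeType_iff_forall_typeProj_of_typeShift h𝒳 A A (show 2 + 2 * p = 2 * (p + 1) by ring)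
    ((fiberGysin hf t p) ∘ₗ (complexBetti.map (fiberι f t) (2 * p)).hom)
    (fun pq' c hc ↦ fiberGysin_map_fiberι_mem_typePiece hf t A pq' c hc) hpq x
  rw [LinearMap.comp_apply] at h1
  change IsOfHodgeType (d + 1) 𝒳 (2 * (p + 1)) (p' + 1) (q' + 1)
      (fiberGysin hf t p (complexBetti.map (fiberι f t) (2 * p) x)) ↔ _ at h1
  rw [h1, isOfHodgeType_map_iff_forall_typeProj h𝒳 hXt (fiberι f t) A hpq x]
  refine forall₂_congr fun pq' _ ↦ ⟨fun h ↦ ?_, fun h ↦ ?_⟩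
  · exact fibreGysinKernelOn_holds hf p t t _ h
  · change fiberGysin hf t p (complexBetti.map (fiberι f t) (2 * p) (A.typeProj (2 * p) pq' x)) = 0
    have h' : complexBetti.map (fiberι f t) (2 * p) (A.typeProj (2 * p) pq' x) = 0 := h
    rw [h', map_zero]

/-- **THE HABITAT CLAUSE ON THE TOTAL SPACE**: every invariant class of degree `2p` is of type `(p,p)` on `𝒳_t` iff every
fibre-class multiple `x ∪ [𝒳_t]`, `x ∈ H^{2p}(𝒳(ℂ); ℂ)`, is of type `(p+1,p+1)` on `𝒳`. [cite: DeligneHodgeII1971, Cor. 4.1.2]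
[cite: VoisinHodgeI2002, §7.3.2] -/
theorem forall_hodgeType_map_fiberι_iff_forall_fiberGysin (hf : IsCompactAbelianPencil f d) (t : ComplexPoints S) (p : ℕ) :
    (∀ x : complexBetti 𝒳 (2 * p), IsOfHodgeType d (fiberOver f t) (2 * p) p p (complexBetti.map (fiberι f t) (2 * p) x)) ↔
      ∀ x : complexBetti 𝒳 (2 * p), IsOfHodgeType (d + 1) 𝒳 (2 * (p + 1)) (p + 1) (p + 1)
        (fiberGysin hf t p (complexBetti.map (fiberι f t) (2 * p) x)) :=
  forall_congr' fun x ↦ (isOfHodgeType_fiberGysin_map_fiberι_iff hf t (show p + p = 2 * p by ring) x).symm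

/-- **An invariant class whose fibre-class multiple is ALGEBRAIC is of type `(p,p)` on the fibre** (algebraic classes are of type
`(p+1,p+1)`; apply the detection theorem). So in (Div)'s hypothesis "`L_t x ∈ N^{p+1}(𝒳)`" the class `j_t^* x` is automatically a
`(p,p)`-class. [cite: VoisinHodgeI2002, §11.3 Prop. 11.20 and §7.3.2] -/
theorem isOfHodgeType_map_fiberι_of_fiberGysin_mem_algebraicClasses (hf : IsCompactAbelianPencil f d) (t : ComplexPoints S)
    {p : ℕ} {x : complexBetti 𝒳 (2 * p)}
    (hx : fiberGysin hf t p (complexBetti.map (fiberι f t) (2 * p) x) ∈ algebraicClasses 𝒳 (p + 1)) :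
    IsOfHodgeType d (fiberOver f t) (2 * p) p p (complexBetti.map (fiberι f t) (2 * p) x) :=
  (isOfHodgeType_fiberGysin_map_fiberι_iff hf t (show p + p = 2 * p by ring) x).1
    (isOfHodgeType_of_mem_algebraicClasses_of_isSmoothProjective hf.isSmoothProjective_total (p + 1) hx)

/-- **(N_p f)(t) ⟺ "every `x ∪ [𝒳_t]` is of type `(p+1,p+1)` on `𝒳`", modulo `HC^p(𝒳)`** (the Hodge conjecture for the total
space in codimension `p`, a HYPOTHESIS — a theorem for `p ≤ 1`): part XVI-b's off-diagonal criterion moved to the total space.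
[cite: VoisinHodgeI2002, §11.3.3 Lemma 11.41] [cite: DeligneHodgeII1971, (4.1.3.1)] -/
theorem algebraicInvariantClassesAt_iff_forall_isOfHodgeType_fiberGysin_of_hodgeClassesAlgebraic (hf : IsCompactAbelianPencil f d)
    (t : ComplexPoints S) (p : ℕ)
    (hHC : ∀ c : complexBetti 𝒳 (2 * p), IsRationalClass c → IsOfHodgeType (d + 1) 𝒳 (2 * p) p p c →
      c ∈ algebraicClasses 𝒳 p) :
    AlgebraicInvariantClassesAt hf t p ↔
      ∀ x : complexBetti 𝒳 (2 * p), IsOfHodgeType (d + 1) 𝒳 (2 * (p + 1)) (p + 1) (p + 1)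
        (fiberGysin hf t p (complexBetti.map (fiberι f t) (2 * p) x)) := by
  rw [algebraicInvariantClassesAt_iff_offDiagonal_vanish_of_hodgeClassesAlgebraic hf t p hHC,
    ← hodgeType_pp_map_fiberι_iff_offDiagonal_vanish hf t p, forall_hodgeType_map_fiberι_iff_forall_fiberGysin hf t p]

end Pencil

end Summit.HodgeConjecture.HodgeConjecture.Ring2.AbelianAll

end
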